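import Summits.ResolutionOfSingularities.ResolutionOfSingularities.Theorems.FrobeniusClosingPatchingRelPerfectDepthGradedTargets
import Summits.ResolutionOfSingularities.ResolutionOfSingularities.Theorems.FrobeniusClosingPatchingRelPerfectDepthSingleFormBasics
import Summits.ResolutionOfSingularities.ResolutionOfSingularities.Theorems.FrobeniusClosingPatchingRelPerfectDepthWeightedCleanupSNC
import Literature.AlgebraicGeometry.Resolution.VertexBlowupProjectionSmooth
import Literature.AlgebraicGeometry.Resolution.VertexBlowupRationalFunctions
import Literature.AlgebraicGeometry.Resolution.AlterationsLemma411VertexClosed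
import Literature.AlgebraicGeometry.Resolution.PointCentrePermissible
import Literature.AlgebraicGeometry.Resolution.BlowupsExistence
import Literature.AlgebraicGeometry.Resolution.ColonIdealSheafFG
import Literature.AlgebraicGeometry.Motives.ProjectiveSpaceHyperplaneMultiplicity
import HarnessLib

/-!
# Crux `PatchingRelPerfect` (stmt-ResolutionOfSingularities-16161), chain W5.2 — TargetsF4 §5, E-side target
# `ConeVertexResolvable ℓ`: ASSEMBLY (one weight-`ℓ` blowing up of the vertex of the cone)

[OURS · L1 W5.2 · TargetsF4 §5] plan-1 g7 STEER 06:34:44Z (B) (res-type-003 holds `coneVertexResolvable_holds`); split with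
res-D-pv-021 (REVISED SPLIT 06:56:33Z / STATEMENT STUB 07:04:04Z): pv-021 proves the transform identity
(★) `controlledTransform b 𝓘_v 𝓟_G ℓ = 𝓟_F.comap q` for the tree's smooth projection `q = DeJong1996.vertexBlowupProjection b hb`
of ANY blowing up `b` of `ℙ^{m+1}_{κ₀}` in the vertex `v = (0:…:0:1)` (`DeJong1996.vertex`, `DeJong1996.vertexIdealSheaf`), with
corollaries «order `≤ 1` everywhere» and «locally principal», and the permissibility `𝓟_G ≤ 𝓘_v^ℓ`; THIS FILE assembles
the typed target from those three inputs, taken here as HYPOTHESES of `coneVertexResolvable_of` (shape = pv-021's stub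
verbatim) — the by-name closure `coneVertexResolvable_holds` is the one-liner over pv-021's
`…DepthConeVertexTransform.lean` once it is in the tree.

Assembly: `b : P → ℙ^{m+1}` any blowing up in `𝓘_v` (`exists_isBlowup`); `V(𝓘_v) = {v}` with its reduced structure is
regular (`isRegular_subscheme_vanishingIdeal_singleton`); `𝓟_G ≤ 𝓘_v^ℓ` gives the weight-`ℓ` format
`𝓟_G𝒪_P = (𝓘_v𝒪_P)^ℓ · 𝔟'` (`IsBlowup.pow_mul_controlledTransform_eq`), i.e. ONE pure weight-`ℓ` step
(`DepthCleanup.pureWeightedSeq_single`); `𝔟'` is locally principal and of order `≤ 1` everywhere by pv-021's corollaries,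
the local principality of `𝓟_F` on `ℙ^m` being `DepthTargets.projIdealSheaf_single_ne_bot_and_isLocallyPrincipal`
(p506283). Fact-free; nothing here is a statement of the manuscript under review; AI-written, AI review is weaker
than expert review.

## References
* A. J. de Jong, *Smoothness, semi-stability and alterations*, Publ. IHÉS 83 (1996), Lemma 4.11 (proof), p. 68. [DeJong1996]
* R. Hartshorne, *Algebraic Geometry* (1977), II Thm. 8.24, Prop. 5.11 (b). [Hartshorne1977]
* J. Kollár, *Lectures on Resolution of Singularities* (2007), 3.30.2. [Kollar2007]
-/

-- `Summit.<Summit>.<Sub>.Theorems` with `Sub = Summit` (single-conjunct summit, D-0017)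
set_option linter.dupNamespace false

noncomputable section

open CategoryTheory CategoryTheory.Limits AlgebraicGeometry TopologicalSpace
open Literature.AlgebraicGeometry.Resolution Literature.AlgebraicGeometry.Motives
open Literature.AlgebraicGeometry.Resolution.DeJong1996

namespace Summit.ResolutionOfSingularities.ResolutionOfSingularities.Theorems.DepthTargets

universe u

/-- **`ConeVertexResolvable ℓ` from the three vertex-transform inputs** (pv-021's `…DepthConeVertexTransform`: (5) the
permissibility `𝓟_G ≤ 𝓘_v^ℓ`, (3) order `≤ 1` of the weight-`ℓ` controlled transform at every point of any blowing up of
the vertex, (4) its local principality from that of `𝓟_F`): one weight-`ℓ` blowing up of the vertex resolves the cone.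
[cite: DeJong1996, Lemma 4.11 (proof)] [cite: Hartshorne1977, II Thm. 8.24] -/
theorem coneVertexResolvable_of (ℓ : ℕ)
    (hle : ∀ (κ₀ : Type u) [Field κ₀] (m : ℕ) (F : MvPolynomial (Fin (m + 1)) κ₀)
      (hF : F ∈ MvPolynomial.homogeneousSubmodule (Fin (m + 1)) κ₀ ℓ)
      {G : MvPolynomial (Fin (m + 1 + 1)) κ₀} (hG : G ∈ MvPolynomial.homogeneousSubmodule (Fin (m + 1 + 1)) κ₀ ℓ),
      G = MvPolynomial.rename Fin.castSucc F →
      formsIdealSheaf κ₀ (m + 1) ℓ (fun _ : Fin 1 => G) (fun _ => hG) ≤ vertexIdealSheaf m κ₀ ^ ℓ)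
    (hord : ∀ (κ₀ : Type u) [Field κ₀] (m : ℕ) (F : MvPolynomial (Fin (m + 1)) κ₀)
      (hF : F ∈ MvPolynomial.homogeneousSubmodule (Fin (m + 1)) κ₀ ℓ),
      (∀ e : ProjSpace.P m κ₀, idealOrder (formsIdealSheaf κ₀ m ℓ (fun _ : Fin 1 => F) (fun _ => hF)) e ≤ 1) →
      ∀ {G : MvPolynomial (Fin (m + 1 + 1)) κ₀} (hG : G ∈ MvPolynomial.homogeneousSubmodule (Fin (m + 1 + 1)) κ₀ ℓ),
      G = MvPolynomial.rename Fin.castSucc F →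
      ∀ {P : Scheme.{u}} {b : P ⟶ ProjSpace.P (m + 1) κ₀} [IsIntegral P] [IsDominant b]
        (_ : IsBlowup b (vertexIdealSheaf m κ₀)) (x : P),
        idealOrder (controlledTransform b (vertexIdealSheaf m κ₀)
          (formsIdealSheaf κ₀ (m + 1) ℓ (fun _ : Fin 1 => G) (fun _ => hG)) ℓ) x ≤ 1)
    (hlp : ∀ (κ₀ : Type u) [Field κ₀] (m : ℕ) (F : MvPolynomial (Fin (m + 1)) κ₀)
      (hF : F ∈ MvPolynomial.homogeneousSubmodule (Fin (m + 1)) κ₀ ℓ),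
      IsLocallyPrincipal (formsIdealSheaf κ₀ m ℓ (fun _ : Fin 1 => F) (fun _ => hF)) →
      ∀ {G : MvPolynomial (Fin (m + 1 + 1)) κ₀} (hG : G ∈ MvPolynomial.homogeneousSubmodule (Fin (m + 1 + 1)) κ₀ ℓ),
      G = MvPolynomial.rename Fin.castSucc F →
      ∀ {P : Scheme.{u}} {b : P ⟶ ProjSpace.P (m + 1) κ₀} [IsIntegral P] [IsDominant b]
        (_ : IsBlowup b (vertexIdealSheaf m κ₀)),
        IsLocallyPrincipal (controlledTransform b (vertexIdealSheaf m κ₀)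
          (formsIdealSheaf κ₀ (m + 1) ℓ (fun _ : Fin 1 => G) (fun _ => hG)) ℓ)) :
    ConeVertexResolvable.{u} ℓ := by
  intro κ₀ _ m F hF hF0 hreg G hG hGF
  -- notation
  set C : (ProjSpace.P (m + 1) κ₀).IdealSheafData := vertexIdealSheaf m κ₀ with hC
  set 𝓟 := formsIdealSheaf κ₀ (m + 1) ℓ (fun _ : Fin 1 => G) (fun _ => hG) with h𝓟
  -- one blowing up of the vertex
  obtain ⟨P, b, hb⟩ := exists_isBlowup (ProjSpace.P (m + 1) κ₀) C
  haveI : IsIntegral P := isIntegral_of_isBlowup_vertex hb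
  haveI : IsDominant b := isDominant_of_isBlowup_vertex hb
  -- the centre (the reduced vertex) is regular, and weight-`ℓ` permissible for `𝓟`
  haveI : IsLocallyNoetherian (ProjSpace.P (m + 1) κ₀) := ProjSpace.isLocallyNoetherian_P
  have hCreg : Scheme.IsRegular C.subscheme :=
    isRegular_subscheme_vanishingIdeal_singleton (isClosed_singleton_vertex m κ₀)
  have hperm : 𝓟 ≤ C ^ ℓ := hle κ₀ m F hF hG hGF
  -- the weight-`ℓ` controlled transform and its format
  set 𝔟' : P.IdealSheafData := controlledTransform b C 𝓟 ℓ with h𝔟'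
  have hfmt : 𝓟.comap b = C.comap b ^ ℓ * 𝔟' :=
    (hb.pow_mul_controlledTransform_eq (by
      rw [← comap_pow]; exact Scheme.IdealSheafData.comap_mono (f := b) hperm)).symm
  refine ⟨P, b, 𝔟', DepthCleanup.pureWeightedSeq_single b 𝓟 𝔟' C hCreg hperm hb hfmt, ?_, fun x => ?_⟩
  · exact hlp κ₀ m F hF
      (projIdealSheaf_single_ne_bot_and_isLocallyPrincipal κ₀ m ℓ (fun _ : Fin 1 => F) (fun _ => hF) hF0).2
      hG hGF hb
  · exact hord κ₀ m F hF hreg hG hGF hb x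

end Summit.ResolutionOfSingularities.ResolutionOfSingularities.Theorems.DepthTargets

end
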